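import Summits.Ventures.Crystal3D.Theorems.StickyWulffConstantTextureLiminfLayerRows
import Summits.Ventures.Crystal3D.Theorems.StickyWulffConstantGenericWallFloorBarlowLineFamily
import HarnessLib

/-!
# Row F4 in lane T's format, part 1: lane T's ROW INDEX `(k, j)` (`layerSite σ L z k i j`) versus plate sites, the finite ROW SET
# through a finite set of window balls, and the CROSSING FAMILY of a set of window rows
# (crux `GenericWallFloor`, stmt-Ventures-19480, line `WallLedgerG`; lane T's row corner, cf-p1 DECISION (xxxvii⁗), wulff-p2 `…RowStripDefs`)

HONEST FRAMING. Venture `Summits/Ventures/Crystal3D` (cell `crystal3d-full`), helper `--supports` the crux `GenericWallFloor`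
(stmt-Ventures-19480) of `route-Ventures-StickyWulffConstant`, registered line `WallLedgerG`, open stub `stub_twoSlabAdhesion`.
Rung credit only; F-C1 not moved; NOT the stub.  Row analogue of `…BarlowLineSet` / `…BarlowLineFamily` (zigzag lines `t : Fin 2 → ℤ`):
lane T indexes the in-layer rows of the plate `(L, σ)` toward `z` by `(k, j) : ℤ × ℤ`, sites `i ↦ layerSite σ L z k i j =
barlowPos σ k 0 0 + i·w + j·w′` (`w = bestLayerDir L z`, `w′ = bestLayerPartner L z`, `…TextureLiminfLayerRows`).

* `exists_rowCoeffs` — integers `a₀ b₀ a₁ b₁` with `w = a₀u + b₀v`, `w′ = a₁u + b₁v`, `a₀b₁ − a₁b₀ = 1`; hence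
  `layerSite_eq_barlowPos` (every row site is a plate site of layer `k`, explicitly) and `barlowPos_eq_layerSite` (every plate site
  of layer `k` lies on exactly one row `(k, j)` at one position `i`), `layerSite_injective`;
* `rowSet_of_sites` — for a finite set `P` of moved plate sites, a finite set `Tr` of row indices containing every row with a site in
  `P`, each member having one, `#Tr ≤ #P`;
* **`rowLineFamily_spec`** — for a finite set `Tr` of rows each with a site of `z`-height in `[H, H+1]` at lateral radius `≤ ρw`, and
  heights increasing by `⟪L w, z⟫ ≥ δ > 0` along rows: the LOWEST site of height `≥ H` on each row gives maps `ai bi` with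
  `barlowPos σ k (ai) (bi)` on row `(k, j)`, height in `[H, H+1]`, row-predecessor `barlowPos σ k (ai − a₀) (bi − b₀)` strictly below `H`,
  lateral radius `≤ ρw + 1/δ`, and `(k,j) ↦ site` injective — exactly the family data of `rowBottomFamily_spec` / `rowTopFamily_spec`.
WHAT THIS IS NOT: no count; F-C1 not moved.
-/

noncomputable section

namespace Summit.Ventures.Crystal3D.Theorems

open Finset
open Literature.MathematicalPhysics.StatisticalMechanics
open Summit.Ventures.Crystal3D.Cruxes.TextureLiminf.TexShadow (bestLayerDir bestLayerAxis layerRise norm_bestLayerDir)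
open scoped InnerProductSpace

/-! ### Row coefficients -/

/-- **Integer coefficients of the row basis**: `w = a₀u + b₀v`, `w′ = a₁u + b₁v` with `a₀b₁ − a₁b₀ = 1`. -/
theorem exists_rowCoeffs (L : EuclideanSpace ℝ (Fin 3) ≃ₗᵢ[ℝ] EuclideanSpace ℝ (Fin 3)) (z : EuclideanSpace ℝ (Fin 3)) :
    ∃ a₀ b₀ a₁ b₁ : ℤ, a₀ * b₁ - a₁ * b₀ = 1 ∧
      bestLayerDir L z = (a₀ : ℝ) • triangularVec₁ 1 + (b₀ : ℝ) • triangularVec₂ 1 ∧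
      bestLayerPartner L z = (a₁ : ℝ) • triangularVec₁ 1 + (b₁ : ℝ) • triangularVec₂ 1 := by
  obtain ⟨hw, hw'⟩ := bestLayerDir_eq L z
  obtain ⟨sg, hsg, hsgeq⟩ : ∃ sg : ℤ, (sg = 1 ∨ sg = -1) ∧ layerSign L z = (sg : ℝ) := by
    rcases layerSign_cases L z with h | h
    · exact ⟨1, Or.inl rfl, by rw [h]; norm_num⟩
    · exact ⟨-1, Or.inr rfl, by rw [h]; norm_num⟩
  have hsg2 : sg * sg = 1 := by rcases hsg with h | h <;> subst h <;> norm_num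
  rw [hw, hw', hsgeq]
  rcases axis_partner_cases L z with ⟨ha, hp⟩ | ⟨ha, hp⟩ | ⟨ha, hp⟩ <;> rw [ha, hp]
  · exact ⟨sg, 0, 0, sg, by rw [hsg2.symm]; ring, by push_cast; module, by push_cast; module⟩
  · exact ⟨0, sg, -sg, sg, by linear_combination hsg2, by push_cast; module, by push_cast; module⟩
  · exact ⟨sg, -sg, sg, 0, by linear_combination hsg2, by push_cast; module, by push_cast; module⟩

section Rows

variable (σ : ℤ → ℤ) (L : EuclideanSpace ℝ (Fin 3) ≃ₗᵢ[ℝ] EuclideanSpace ℝ (Fin 3)) (s₀ z : EuclideanSpace ℝ (Fin 3))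
  {a₀ b₀ a₁ b₁ : ℤ} (hdet : a₀ * b₁ - a₁ * b₀ = 1)
  (hw : bestLayerDir L z = (a₀ : ℝ) • triangularVec₁ 1 + (b₀ : ℝ) • triangularVec₂ 1)
  (hw' : bestLayerPartner L z = (a₁ : ℝ) • triangularVec₁ 1 + (b₁ : ℝ) • triangularVec₂ 1)

include hw hw' in
/-- **Row sites are plate sites, explicitly**: `layerSite σ L z k i j = barlowPos σ k (a₀i + a₁j) (b₀i + b₁j)`. -/
theorem layerSite_eq_barlowPos (k i j : ℤ) :
    layerSite σ L z k i j = barlowPos 1 (Real.sqrt (2 / 3)) σ k (a₀ * i + a₁ * j) (b₀ * i + b₁ * j) := by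
  unfold layerSite
  have h := barlowPos_add_inplane 1 (Real.sqrt (2 / 3)) σ k 0 0 (a₀ * i + a₁ * j) (b₀ * i + b₁ * j)
  rw [zero_add, zero_add] at h
  rw [hw, hw', ← h]
  push_cast
  module

include hdet hw hw' in
/-- **Every plate site of layer `k` lies on a row**: `barlowPos σ k x y = layerSite σ L z k i j` with
`i = b₁x − a₁y`, `j = a₀y − b₀x`. -/
theorem barlowPos_eq_layerSite (k x y : ℤ) :
    barlowPos 1 (Real.sqrt (2 / 3)) σ k x y = layerSite σ L z k (b₁ * x - a₁ * y) (a₀ * y - b₀ * x) := by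
  have e1 : a₀ * (b₁ * x - a₁ * y) + a₁ * (a₀ * y - b₀ * x) = x := by linear_combination x * hdet
  have e2 : b₀ * (b₁ * x - a₁ * y) + b₁ * (a₀ * y - b₀ * x) = y := by linear_combination y * hdet
  rw [layerSite_eq_barlowPos σ L z hw hw', e1, e2]

include hdet hw hw' in
/-- Row sites are injectively indexed by `(k, i, j)`. -/
theorem layerSite_injective {k i j k' i' j' : ℤ}
    (h : layerSite σ L z k i j = layerSite σ L z k' i' j') : k = k' ∧ i = i' ∧ j = j' := by
  rw [layerSite_eq_barlowPos σ L z hw hw', layerSite_eq_barlowPos σ L z hw hw'] at h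
  obtain ⟨hk, ha, hb⟩ := barlowPos_injective σ h
  refine ⟨hk, ?_, ?_⟩
  · have e1 : i = b₁ * (a₀ * i + a₁ * j) - a₁ * (b₀ * i + b₁ * j) := by linear_combination (-1 : ℤ) * hdet * i
    have e2 : i' = b₁ * (a₀ * i' + a₁ * j') - a₁ * (b₀ * i' + b₁ * j') := by linear_combination (-1 : ℤ) * hdet * i'
    rw [e1, e2, ha, hb]
  · have e1 : j = a₀ * (b₀ * i + b₁ * j) - b₀ * (a₀ * i + a₁ * j) := by linear_combination (-1 : ℤ) * hdet * j
    have e2 : j' = a₀ * (b₀ * i' + b₁ * j') - b₀ * (a₀ * i' + a₁ * j') := by linear_combination (-1 : ℤ) * hdet * j'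
    rw [e1, e2, ha, hb]

/-- Consecutive row sites differ by `w`. -/
theorem layerSite_succ (k i j : ℤ) : layerSite σ L z k (i + 1) j = layerSite σ L z k i j + bestLayerDir L z := by
  unfold layerSite; push_cast; module

/-- Row sites `n` steps apart. -/
theorem layerSite_add_nat (k i j : ℤ) (n : ℕ) : layerSite σ L z k (i + n) j = layerSite σ L z k i j + (n : ℝ) • bestLayerDir L z := by
  unfold layerSite; push_cast; module

/-! ### The finite row set through a finite set of balls -/

include hdet hw hw' in
open scoped Classical in
/-- **Row set of a finite set of plate balls.**  `P` a finite set of moved plate sites: a finite set `Tr` of row indices `(k, j)`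
containing every row with a site (after the motion) in `P`, each of whose members has one; `#Tr ≤ #P`. -/
theorem rowSet_of_sites (P : Finset (EuclideanSpace ℝ (Fin 3)))
    (hP : ∀ q ∈ P, ∃ k x y : ℤ, q = L (barlowPos 1 (Real.sqrt (2 / 3)) σ k x y) + s₀) :
    ∃ Tr : Finset (ℤ × ℤ),
      (∀ kj : ℤ × ℤ, (∃ i : ℤ, L (layerSite σ L z kj.1 i kj.2) + s₀ ∈ P) → kj ∈ Tr) ∧
      (∀ kj ∈ Tr, ∃ i : ℤ, L (layerSite σ L z kj.1 i kj.2) + s₀ ∈ P) ∧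
      Tr.card ≤ P.card := by
  -- the row index of a ball
  set idx : EuclideanSpace ℝ (Fin 3) → ℤ × ℤ := fun q =>
    if h : ∃ kij : ℤ × ℤ × ℤ, L (layerSite σ L z kij.1 kij.2.1 kij.2.2) + s₀ = q then
      ((Classical.choose h).1, (Classical.choose h).2.2) else 0 with hidx
  have hidx_spec : ∀ k i j : ℤ, idx (L (layerSite σ L z k i j) + s₀) = (k, j) := by
    intro k i j
    have h : ∃ kij : ℤ × ℤ × ℤ, L (layerSite σ L z kij.1 kij.2.1 kij.2.2) + s₀ = L (layerSite σ L z k i j) + s₀ := ⟨(k, i, j), rfl⟩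
    simp only [hidx, dif_pos h]
    have hc := Classical.choose_spec h
    have hc' : layerSite σ L z (Classical.choose h).1 (Classical.choose h).2.1 (Classical.choose h).2.2 = layerSite σ L z k i j :=
      L.injective (add_right_cancel hc)
    obtain ⟨hk, -, hj⟩ := layerSite_injective σ L z hdet hw hw' hc'
    rw [hk, hj]
  refine ⟨P.image idx, fun kj ⟨i, hi⟩ => Finset.mem_image.2 ⟨_, hi, ?_⟩, fun kj hkj => ?_, Finset.card_image_le⟩
  · rw [hidx_spec]
  · obtain ⟨q, hq, hqkj⟩ := Finset.mem_image.1 hkj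
    obtain ⟨k, x, y, rfl⟩ := hP q hq
    rw [barlowPos_eq_layerSite σ L z hdet hw hw'] at hq hqkj
    rw [hidx_spec] at hqkj
    subst hqkj
    exact ⟨_, hq⟩

/-! ### The crossing family of a set of window rows -/

/-- Heights along a row grow by at least `δ` per step. -/
theorem height_layerSite_mono {δ : ℝ} (hδ : δ ≤ ⟪L (bestLayerDir L z), z⟫_ℝ) (k i j : ℤ) (n : ℕ) :
    ⟪L (layerSite σ L z k i j) + s₀, z⟫_ℝ + n * δ ≤ ⟪L (layerSite σ L z k (i + n) j) + s₀, z⟫_ℝ := by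
  have key : ⟪L (layerSite σ L z k (i + n) j) + s₀, z⟫_ℝ =
      ⟪L (layerSite σ L z k i j) + s₀, z⟫_ℝ + (n : ℝ) * ⟪L (bestLayerDir L z), z⟫_ℝ := by
    rw [layerSite_add_nat, map_add, LinearIsometryEquiv.map_smul, show L (layerSite σ L z k i j) + (n : ℝ) • L (bestLayerDir L z) + s₀ =
      (L (layerSite σ L z k i j) + s₀) + (n : ℝ) • L (bestLayerDir L z) by abel, inner_add_left ((L (layerSite σ L z k i j) + s₀)),
      real_inner_smul_left]
  have : (n : ℝ) * δ ≤ (n : ℝ) * ⟪L (bestLayerDir L z), z⟫_ℝ := mul_le_mul_of_nonneg_left hδ (Nat.cast_nonneg n)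
  linarith

include hdet hw hw' in
/-- **The crossing family of a set of window rows.**  Rows `Tr`, each with a site of `z`-height in `[H, H+1]` at lateral radius
`≤ ρw`; heights grow by `≥ δ > 0` per row step.  Then the LOWEST site of height `≥ H` on each row yields maps `ai bi` with: the
site `barlowPos σ k (ai) (bi)` lies on row `(k, j)`, has height in `[H, H+1]`, its row-predecessor `barlowPos σ k (ai − a₀) (bi − b₀)`
lies strictly below `H`, its lateral radius is `≤ ρw + 1/δ`, and distinct rows give distinct sites. -/
theorem rowLineFamily_spec {δ : ℝ} (hδ0 : 0 < δ) (hδ : δ ≤ ⟪L (bestLayerDir L z), z⟫_ℝ)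
    (H ρw : ℝ) (Tr : Finset (ℤ × ℤ))
    (hwin : ∀ kj ∈ Tr, ∃ i : ℤ,
      H ≤ ⟪L (layerSite σ L z kj.1 i kj.2) + s₀, z⟫_ℝ ∧ ⟪L (layerSite σ L z kj.1 i kj.2) + s₀, z⟫_ℝ ≤ H + 1 ∧
      Real.sqrt ((L (layerSite σ L z kj.1 i kj.2) + s₀) 0 ^ 2 + (L (layerSite σ L z kj.1 i kj.2) + s₀) 1 ^ 2) ≤ ρw) :
    ∃ ai bi : ℤ × ℤ → ℤ, ∀ kj ∈ Tr,
      (∃ i : ℤ, barlowPos 1 (Real.sqrt (2 / 3)) σ kj.1 (ai kj) (bi kj) = layerSite σ L z kj.1 i kj.2) ∧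
      H ≤ ⟪L (barlowPos 1 (Real.sqrt (2 / 3)) σ kj.1 (ai kj) (bi kj)) + s₀, z⟫_ℝ ∧
      ⟪L (barlowPos 1 (Real.sqrt (2 / 3)) σ kj.1 (ai kj) (bi kj)) + s₀, z⟫_ℝ ≤ H + 1 ∧
      ⟪L (barlowPos 1 (Real.sqrt (2 / 3)) σ kj.1 (ai kj - a₀) (bi kj - b₀)) + s₀, z⟫_ℝ < H ∧
      Real.sqrt ((L (barlowPos 1 (Real.sqrt (2 / 3)) σ kj.1 (ai kj) (bi kj)) + s₀) 0 ^ 2 +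
        (L (barlowPos 1 (Real.sqrt (2 / 3)) σ kj.1 (ai kj) (bi kj)) + s₀) 1 ^ 2) ≤ ρw + 1 / δ ∧
      (∀ kj' ∈ Tr, barlowPos 1 (Real.sqrt (2 / 3)) σ kj.1 (ai kj) (bi kj) = barlowPos 1 (Real.sqrt (2 / 3)) σ kj'.1 (ai kj') (bi kj') →
        kj = kj') := by
  set ht : EuclideanSpace ℝ (Fin 3) → ℝ := fun p => ⟪L p + s₀, z⟫_ℝ with hht
  -- the lowest site of height ≥ H on each row
  have hleast : ∀ kj ∈ Tr, ∃ i₀ : ℤ, H ≤ ht (layerSite σ L z kj.1 i₀ kj.2) ∧ ∀ i : ℤ, H ≤ ht (layerSite σ L z kj.1 i kj.2) → i₀ ≤ i := by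
    intro kj hkj
    obtain ⟨iw, h1', h2', -⟩ := hwin kj hkj
    have h1 : H ≤ ht (layerSite σ L z kj.1 iw kj.2) := h1'
    have h2 : ht (layerSite σ L z kj.1 iw kj.2) ≤ H + 1 := h2'
    refine Int.exists_least_of_bdd ⟨iw - (⌈1 / δ⌉ + 1), fun i hi => ?_⟩ ⟨iw, h1⟩
    by_contra hlt
    push Not at hlt
    have hceil : (0 : ℤ) ≤ ⌈(1 / δ : ℝ)⌉ := Int.ceil_nonneg (by positivity)
    obtain ⟨n, hn⟩ := Int.eq_ofNat_of_zero_le (by omega : (0 : ℤ) ≤ iw - i)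
    have hmono := height_layerSite_mono σ L s₀ z hδ kj.1 i kj.2 n
    rw [show i + (n : ℤ) = iw by omega] at hmono
    have hn1 : (1 / δ : ℝ) + 1 ≤ n := by
      have h3 : (⌈1 / δ⌉ : ℝ) + 1 < ((iw - i : ℤ) : ℝ) := by exact_mod_cast (by omega : ⌈1 / δ⌉ + 1 < iw - i)
      rw [hn] at h3; push_cast at h3
      have := Int.le_ceil (1 / δ); linarith
    have h4 : 1 + δ ≤ n * δ := by
      have := mul_le_mul_of_nonneg_right hn1 hδ0.le
      rw [add_mul, one_div, inv_mul_cancel₀ hδ0.ne'] at this; linarith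
    have : ht (layerSite σ L z kj.1 i kj.2) + n * δ ≤ ht (layerSite σ L z kj.1 iw kj.2) := hmono
    simp only [hht] at this hi h2
    linarith
  choose! i₀ hi₀ using hleast
  refine ⟨fun kj => a₀ * i₀ kj + a₁ * kj.2, fun kj => b₀ * i₀ kj + b₁ * kj.2, fun kj hkj => ?_⟩
  obtain ⟨hP, hmin⟩ := hi₀ kj hkj
  have heq : barlowPos 1 (Real.sqrt (2 / 3)) σ kj.1 (a₀ * i₀ kj + a₁ * kj.2) (b₀ * i₀ kj + b₁ * kj.2) = layerSite σ L z kj.1 (i₀ kj) kj.2 :=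
    (layerSite_eq_barlowPos σ L z hw hw' kj.1 (i₀ kj) kj.2).symm
  have hpredeq : barlowPos 1 (Real.sqrt (2 / 3)) σ kj.1 (a₀ * i₀ kj + a₁ * kj.2 - a₀) (b₀ * i₀ kj + b₁ * kj.2 - b₀) =
      layerSite σ L z kj.1 (i₀ kj - 1) kj.2 := by
    rw [layerSite_eq_barlowPos σ L z hw hw']; congr 1 <;> ring
  obtain ⟨iw, h1', h2', h3'⟩ := hwin kj hkj
  have h1 : H ≤ ht (layerSite σ L z kj.1 iw kj.2) := h1'
  have h2 : ht (layerSite σ L z kj.1 iw kj.2) ≤ H + 1 := h2'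
  have h3 : Real.sqrt ((L (layerSite σ L z kj.1 iw kj.2) + s₀) 0 ^ 2 + (L (layerSite σ L z kj.1 iw kj.2) + s₀) 1 ^ 2) ≤ ρw := h3'
  have hle : i₀ kj ≤ iw := hmin iw h1
  obtain ⟨n, hn⟩ := Int.eq_ofNat_of_zero_le (sub_nonneg.2 hle)
  have hiw : iw = i₀ kj + n := by omega
  have hmono := height_layerSite_mono σ L s₀ z hδ kj.1 (i₀ kj) kj.2 n
  rw [← hiw] at hmono
  have hnδ : (n : ℝ) * δ ≤ 1 := by simp only [hht] at hP hmono h2; linarith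
  have hn_le : (n : ℝ) ≤ 1 / δ := by rw [le_div_iff₀ hδ0]; exact hnδ
  refine ⟨⟨i₀ kj, heq⟩, ?_, ?_, ?_, ?_, ?_⟩
  · rw [heq]; exact hP
  · rw [heq]
    have h0 : (0 : ℝ) ≤ n * δ := by positivity
    have : ht (layerSite σ L z kj.1 (i₀ kj) kj.2) ≤ ht (layerSite σ L z kj.1 iw kj.2) := by simp only [hht] at hmono ⊢; linarith
    exact this.trans h2
  · -- the predecessor is below H by minimality
    rw [hpredeq]
    by_contra hge
    push Not at hge
    have := hmin (i₀ kj - 1) hge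
    omega
  · -- lateral radius: within n ≤ 1/δ unit steps of the window site
    rw [heq]
    have hdist : dist (L (layerSite σ L z kj.1 (i₀ kj) kj.2) + s₀) (L (layerSite σ L z kj.1 iw kj.2) + s₀) ≤ n := by
      rw [dist_eq_norm, show L (layerSite σ L z kj.1 (i₀ kj) kj.2) + s₀ - (L (layerSite σ L z kj.1 iw kj.2) + s₀) =
        L (layerSite σ L z kj.1 (i₀ kj) kj.2) - L (layerSite σ L z kj.1 iw kj.2) by abel, ← map_sub, LinearIsometryEquiv.norm_map,
        hiw, layerSite_add_nat, show layerSite σ L z kj.1 (i₀ kj) kj.2 - (layerSite σ L z kj.1 (i₀ kj) kj.2 + (n : ℝ) • bestLayerDir L z) =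
        -((n : ℝ) • bestLayerDir L z) by abel, norm_neg, norm_smul, norm_bestLayerDir, mul_one, Real.norm_eq_abs,
        abs_of_nonneg (Nat.cast_nonneg n)]
    have hr := lateral_radius_le_add_dist (L (layerSite σ L z kj.1 (i₀ kj) kj.2) + s₀) (L (layerSite σ L z kj.1 iw kj.2) + s₀)
    linarith
  · intro kj' hkj' hpt
    have heq' : barlowPos 1 (Real.sqrt (2 / 3)) σ kj'.1 (a₀ * i₀ kj' + a₁ * kj'.2) (b₀ * i₀ kj' + b₁ * kj'.2) =
        layerSite σ L z kj'.1 (i₀ kj') kj'.2 := (layerSite_eq_barlowPos σ L z hw hw' kj'.1 (i₀ kj') kj'.2).symm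
    have h := hpt
    rw [heq, heq'] at h
    obtain ⟨hk, -, hj⟩ := layerSite_injective σ L z hdet hw hw' h
    exact Prod.ext hk hj

end Rows

end Summit.Ventures.Crystal3D.Theorems

end
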